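import Summits.Ventures.PercRepro.RankLevelSetBiIndepContainNormClass
import Summits.Ventures.PercRepro.RankLevelSetBiIndepContainNormRankThree

/-! # RankLevelSetBiIndepContainNormReduce — THE REDUCTIONS OF (CUM-norm) IN THE `Prop` VOCABULARY: LOOPS, PARALLEL
PAIRS, AND EVERY MATROID OF RANK ≤ 3 SATISFY `BiContainNormSkew`; HENCE MONO FOR EVERY MATROID OF RANK ≤ 3
(night-1 g31; dossier §42.20–§42.21, §43.0)

Wrappers of the unfolded theorems `biContainNormSkew_of_loop'`, `biContainNormSkew_of_parallel'` and
`biContainNormSkew_of_eRank_le_three'` against the `Prop` `BiContainNormSkew` of `RankLevelSetBiIndepContainNorm`,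
and their consequences: a matroid of rank ≤ 3 satisfies the cumulative (CX*) on every contain-set
(`minorPairSkew_contain_of_eRank_le_three`), every minor of a matroid of rank ≤ 3 has rank ≤ 3
(`eRank_le_of_isMinor`), hence the monotone form of the bi-independent profile — C-025's residue Mono — holds for
every matroid of rank ≤ 3 (**`biIndepMono_of_eRank_le_three`**) and the per-element inequality (★★) with it
(**`biIndepPerElem_of_eRank_le_three`**). Every declaration has a docstring; imports: the cell's own modules and
Mathlib only. Axioms: standard. -/

namespace PercRepro

open Set Matroid

variable {α : Type} (M : Matroid α) [M.Finite]

omit [M.Finite] in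
/-- **A matroid with a loop satisfies (CUM-norm)** (every contain profile is empty). -/
theorem biContainNormSkew_of_loop {ℓ : α} (hℓE : ℓ ∈ M.E) (hℓ : ¬ M.Indep {ℓ}) : BiContainNormSkew M :=
  biContainNormSkew_of_loop' M hℓE hℓ

/-- **The parallel-pair reduction of (CUM-norm)**: for a parallel pair `{y, z}`, (CUM-norm) of `M ／ {y} ＼ {z}`
gives (CUM-norm) of `M`. -/
theorem biContainNormSkew_of_parallel {y z : α} (h : ParallelPair M y z)
    (hN : BiContainNormSkew ((M.contract {y}).delete {z})) : BiContainNormSkew M :=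
  biContainNormSkew_of_parallel' M h hN

/-- **Every matroid of rank ≤ 3 satisfies (CUM-norm).** -/
theorem biContainNormSkew_of_eRank_le_three (hr : M.eRank ≤ 3) : BiContainNormSkew M :=
  biContainNormSkew_of_eRank_le_three' M.E.ncard M rfl hr

/-- **Every matroid of rank ≤ 3 satisfies the cumulative (CX*) on every contain-set.** -/
theorem minorPairSkew_contain_of_eRank_le_three (hr : M.eRank ≤ 3) :
    ∀ X ⊆ M.E, MinorPairSkew M X ∅ (M.E.ncard - 2 * X.ncard - 1) :=
  minorPairSkew_contain_of_normSkew M (biContainNormSkew_of_eRank_le_three M hr)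

omit [M.Finite] in
/-- **The rank of a minor is at most the rank of the matroid**: an independent set of the minor is independent in
`M`. -/
lemma eRank_le_of_isMinor {N : Matroid α} (hN : Matroid.IsMinor N M) : N.eRank ≤ M.eRank := by
  rw [Matroid.eRank_def, Matroid.eRk_le_iff]
  intro I _ hI
  exact (hI.of_isMinor hN).encard_le_eRank

/-- **Every matroid of rank ≤ 3 satisfies the per-element inequality (★★)**: every minor has rank ≤ 3, hence
(CUM-norm). -/
theorem biIndepPerElem_of_eRank_le_three (hr : M.eRank ≤ 3) : BiIndepPerElem M :=
  biIndepPerElem_of_forall_minor_normSkew M fun N hN =>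
    haveI : N.Finite := ⟨M.ground_finite.subset hN.subset⟩
    biContainNormSkew_of_eRank_le_three N ((eRank_le_of_isMinor M hN).trans hr)

/-- **Every matroid of rank ≤ 3 satisfies Mono**, the monotone form of its bi-independent profile:
`(#E − j)·D_j ≤ (j + 1)·D_{j+1}` for `2j + 1 < #E`. -/
theorem biIndepMono_of_eRank_le_three (hr : M.eRank ≤ 3) : BiIndepMono M :=
  biIndepMono_of_forall_minor_normSkew M fun N hN =>
    haveI : N.Finite := ⟨M.ground_finite.subset hN.subset⟩
    biContainNormSkew_of_eRank_le_three N ((eRank_le_of_isMinor M hN).trans hr)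

end PercRepro
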